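import Literature.Topology.FourManifolds.FlowerMelon

/-!
# Crux `AgkCor6Sufficiency` (item stmt-SmoothPoincare4-10894), line `lp-by-sphere-system-surgery`:
# vocabulary of the punctured flower model (lead reshape r6b, stub `stub_puncturedFlowerModel`)

The ONE model computation left in the marking statement `GeomMarkingStmt3k` is
`PuncturedFlowerModel g` (`…GeomMarkingDefs.lean`): Juhász's flower surface
`Z_g = FlowerModel.flowerSurface g ⊂ ℝ³` (`g ≥ 2`) carries a chart-like `2`-cell with a genus-`g`
cell basis — `Z_g` minus a disc has free `π₁` of rank `2g` reading the boundary circle as `r_g`.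
The line's plan ("capped melon"): the cell is the graph of the upper sheet over the small planar
disc `B(0, 1/2)` about the origin (the hole being the graph over `B(0, 1/4)`, the *polar cap* at
the upper pole `0⁺`); `Z_g` minus the cap is the union of the `g` melon slices
(`FlowerModel.secS`) minus their polar tips, glued LINEARLY along the arcs `FlowerModel.arcK`
truncated at the cap circle — all of which keep the lower pole `0⁻`, the base point — by `g`
applications of `exists_basis_union_of_arc` (no closing circle step: the last slice meets the
first only in the lower pole and the truncated arcs); the slice bases come from
`FlowerModel.exists_basis_secS` through the tip-bite isomorphism, the collars from the fan collars
(which never move a point of planar radius `≥ 1/4` below `1/4`), and the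
boundary word telescopes to the cap circle.

This file fixes the VOCABULARY: the cap radius `capR = 1/4`,
the planar cell map `capA` and the cell `capΨ` (upper sheet over `capA`), the open cap region
`capU ⊂ ℝ³`, the capped slices `capS`, the cap points `capPt` where the arcs cross the cap circle,
the truncated arcs `tArcFun` (lower pole → cap circle, a reparametrisation of
`FlowerModel.vArcFun` rotated by `FlowerModel.Rk`) and the cap-circle arcs `capArcFun` inside the
slices.  The lemmas about them are the registered `helper_cap*` stubs of the line.

References: Hatcher, Algebraic Topology (2002), §1.2 p. 51; Gay–Kirby, Geom. Topol. 20 (2016),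
Def. 1 (the central surface is a closed orientable genus-`g` surface).
-/

set_option linter.dupNamespace false

noncomputable section

open Set Function Metric
open scoped Real

namespace Summit.SmoothPoincare4.SmoothPoincare4.Cruxes.AgkCor6Sufficiency.LpBySphereSystemSurgery

open Literature.Topology.FourManifolds Literature.Topology.FourManifolds.FlowerModel
open PlanarThickening PlanarDouble

namespace FlowerCap

variable {g : ℕ}

/-- The planar radius of the removed polar cap (the hole of the cell): `1/4`.  This is the radius
below which the tree's collar deformations are purely angular (`FlowerModel.fanψ_of_norm_le`:
radius preserved for `‖u‖ ≤ 1/4`) resp. above which the last collar is the flower-preserving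
squeeze (`FlowerModel.lam2_eq_one` for `1/4 ≤ r`), so that NO collar deformation of the melon ever
moves a point of planar radius `≥ 1/4` below `1/4` (`FlowerModel.norm_le_Rtot`,
`FlowerModel.norm_le_Rtot2`): the capped pieces are invariant under all of them. -/
def capR : ℝ := 1 / 4

/-- The planar cell map `w ↦ (1/4) · rot(e^{iπ/g}) w` on `ℝ²`: `‖capA w‖ = ‖w‖ / 4` (so the cell,
`‖w‖ ≤ 2`, has planar radius `≤ 1/2`, where `flower ≤ 3/8 < 1 ≤ level`), and the model base point
`(1, 0)` goes to `pol (1/4) (π/g)`, under the valley arc `vArc`. -/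
def capA (g : ℕ) (w : EuclideanSpace ℝ (Fin 2)) : EuclideanSpace ℝ (Fin 2) :=
  capR • rot (Circle.exp (π / g)) w

/-- The cap cell map into `ℝ³`: the point of the UPPER sheet of the flower surface over `capA w`. -/
def capΨ (g : ℕ) (w : EuclideanSpace ℝ (Fin 2)) : EuclideanSpace ℝ (Fin 3) :=
  upperPt (flower g) (level g) (capA g w)

/-- The open polar cap region of `ℝ³`: planar radius `< 1/4`, upper half-space.  Its trace on the
flower surface is the hole `capΨ(B(0,1))`. -/
def capU : Set (EuclideanSpace ℝ (Fin 3)) :=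
  {p | ‖proj p‖ < capR ∧ 0 < p 2}

/-- The `k`-th capped slice: the `k`-th melon slice minus the polar cap. -/
def capS (g : ℕ) (k : ℕ) : Set (EuclideanSpace ℝ (Fin 3)) :=
  secS g k \ capU

/-- The `k`-th polar box: the part of the `k`-th slice of planar radius `≤ 1/2` on the upper
sheet — the graph over the planar pizza slice `secW g k ∩ B̄(0, 1/2)` (a convex planar sector,
opening angle `2π/g ≤ π`), containing the bite `secS g k ∩ capU` at its vertex. -/
def capBox (g : ℕ) (k : ℕ) : Set (EuclideanSpace ℝ (Fin 3)) :=
  secS g k ∩ {p | ‖proj p‖ ≤ 1 / 2 ∧ 0 ≤ p 2}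

/-- The point where the `k`-th arc `arcK hg k` crosses the cap circle (upper sheet, planar radius
`1/4` on the `k`-th valley ray). -/
def capPt (hg : 2 ≤ g) (k : ℕ) : EuclideanSpace ℝ (Fin 3) :=
  Rk g k (vArcFun hg capR)

/-- The `k`-th truncated arc as a function on `ℝ` (used on `[0, 1]`): from the lower pole `0⁻`
(`t = 0`) up the `k`-th arc to the cap point `capPt hg k` (`t = 1`); a reparametrisation of
`vArcFun hg` on `[1/4, 2ρ₄]`, rotated by `Rk g k`. -/
def tArcFun (hg : 2 ≤ g) (k : ℕ) (t : ℝ) : EuclideanSpace ℝ (Fin 3) :=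
  Rk g k (vArcFun hg (2 * rho4 hg - t * (2 * rho4 hg - capR)))

/-- The cap-circle arc inside the `k`-th slice as a function on `ℝ` (used on `[0, 1]`): on the
upper sheet at planar radius `1/4`, from the cap point of the `k`-th arc (`t = 0`, angle `π/g`
before rotation) to that of the `(k+1)`-st (`t = 1`, angle `-π/g` before rotation). -/
def capArcFun (g : ℕ) (k : ℕ) (t : ℝ) : EuclideanSpace ℝ (Fin 3) :=
  Rk g k (upperPt (flower g) (level g) (pol capR ((1 - 2 * t) * π / g)))

/-- Unfolding `capR`. -/
theorem capR_eq : capR = 1 / 4 := rfl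

/-- `capR` is positive. -/
theorem capR_pos : 0 < capR := by rw [capR_eq]; norm_num

/-- Unfolding `tArcFun` at `t = 0`: the lower pole side, `vArcFun hg (2ρ₄)` rotated. -/
theorem tArcFun_zero (hg : 2 ≤ g) (k : ℕ) : tArcFun hg k 0 = Rk g k (vArcFun hg (2 * rho4 hg)) := by
  simp [tArcFun]

/-- Unfolding `tArcFun` at `t = 1`: the cap point. -/
theorem tArcFun_one (hg : 2 ≤ g) (k : ℕ) : tArcFun hg k 1 = capPt hg k := by
  simp [tArcFun, capPt]

/-! ### The truncated arcs and the cap-circle arcs as paths -/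

/-- The rotations `Rk` on points written as `lift u + h • ez`: rotate the planar part. -/
theorem Rk_lift_add (k : ℕ) (u : EuclideanSpace ℝ (Fin 2)) (h : ℝ) :
    Rk g k (lift u + h • ez) = lift (rot (ζC g k)⁻¹ u) + h • ez := by
  rw [Rk, rot3_apply, map_add, map_smul, proj_lift, proj_ez, smul_zero, add_zero]
  congr 1
  simp

/-- The rotations `Rk` on points over polar planar points: add the angle `ν_k = -2kπ/g`. -/
theorem Rk_lift_pol_add (k : ℕ) (r θ h : ℝ) :
    Rk g k (lift (pol r θ) + h • ez) = lift (pol r (θ + νk g k)) + h • ez := by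
  rw [Rk_lift_add, ζC_inv_eq_exp, rot_exp_pol]

/-- `1/4 ≤ ρ₄` (indeed `ρ₄ > ρ₁ > 4/5`). -/
theorem capR_le_rho4 (hg : 2 ≤ g) : capR ≤ rho4 hg := by
  have h1 := (rho1_mem hg).1
  have h2 := rho1_lt_rt_seven hg
  have h3 := rt_seven_lt_rho4 hg
  rw [capR_eq]
  linarith

/-- The flower function on the circle of radius `r` at the mirrored valley angle `-π/g` takes the
valley value `vprof r` (as at `π/g`). -/
theorem flower_pol_neg_valley (hg : 1 ≤ g) (r : ℝ) : flower g (pol r (-(π / g))) = vprof g r := by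
  have hg0 : (g : ℝ) ≠ 0 := by exact_mod_cast (show g ≠ 0 by omega)
  rw [flower_pol, vprof, show (g : ℝ) * -(π / g) = -π by field_simp, Real.cos_neg, Real.cos_pi]
  ring

/-- The upper-sheet point over `pol (1/4) (π/g)` is the point `vArcFun hg (1/4)` of the valley arc. -/
theorem upperPt_pol_valley_eq_vArcFun (hg : 2 ≤ g) :
    upperPt (flower g) (level g) (pol capR (π / g)) = vArcFun hg capR := by
  rw [vArcFun_of_le hg (capR_le_rho4 hg), upperPt, flower_pol_valley (by omega)]
  rfl

/-- The cap point of the `k`-th arc, in coordinates. -/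
theorem capPt_eq (hg : 2 ≤ g) (k : ℕ) :
    capPt hg k = lift (pol capR (π / g + νk g k)) + vHt g capR • ez := by
  rw [capPt, vArcFun_of_le hg (capR_le_rho4 hg), Rk_lift_pol_add]

/-- The cap-circle arc function, in coordinates. -/
theorem capArcFun_eq (k : ℕ) (t : ℝ) :
    capArcFun g k t = lift (pol capR ((1 - 2 * t) * π / g + νk g k)) +
      Real.sqrt (level g - flower g (pol capR ((1 - 2 * t) * π / g))) • ez := by
  rw [capArcFun, upperPt, Rk_lift_pol_add]

/-- The cap-circle arc starts at the cap point of the `k`-th arc. -/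
theorem capArcFun_zero (hg : 2 ≤ g) (k : ℕ) : capArcFun g k 0 = capPt hg k := by
  rw [capArcFun, capPt, ← upperPt_pol_valley_eq_vArcFun hg]
  congr 2
  ring

/-- The cap-circle arc ends at the cap point of the `(k+1)`-st arc. -/
theorem capArcFun_one (hg : 2 ≤ g) (k : ℕ) : capArcFun g k 1 = capPt hg (k + 1) := by
  have hg1 : 1 ≤ g := by omega
  rw [capArcFun_eq, capPt_eq, show (1 - 2 * (1 : ℝ)) * π / g = -(π / g) by ring,
    flower_pol_neg_valley hg1, vHt]
  congr 3
  simp only [νk]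
  push_cast
  ring

/-- The truncated arc function starts at the lower pole. -/
theorem tArcFun_zero_eq_bot (hg : 2 ≤ g) (k : ℕ) : tArcFun hg k 0 = bot g := by
  rw [tArcFun_zero, vArcFun_two_mul, Rk_bot]

/-- The truncated arc function is continuous. -/
theorem continuous_tArcFun (hg : 2 ≤ g) (k : ℕ) : Continuous (tArcFun hg k) := by
  have h0 : Continuous fun t : ℝ => 2 * rho4 hg - t * (2 * rho4 hg - capR) :=
    continuous_const.sub (continuous_id.mul continuous_const)
  show Continuous fun t => Rk g k (vArcFun hg (2 * rho4 hg - t * (2 * rho4 hg - capR)))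
  exact (Rk g k).continuous.comp ((continuous_vArcFun hg).comp h0)

/-- The cap-circle arc function is continuous. -/
theorem continuous_capArcFun (g : ℕ) (k : ℕ) : Continuous (capArcFun g k) := by
  have h0 : Continuous fun t : ℝ => ((1 - 2 * t) * π / g : ℝ) :=
    ((continuous_const.sub (continuous_const.mul continuous_id)).mul continuous_const).div_const _
  have h1 : Continuous fun t : ℝ => pol capR ((1 - 2 * t) * π / g) := by
    show Continuous ((fun x : ℝ × ℝ => pol x.1 x.2) ∘ fun t : ℝ => (capR, (1 - 2 * t) * π / g))
    exact continuous_pol.comp (continuous_const.prodMk h0)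
  have h2 : Continuous (upperPt (flower g) (level g)) :=
    continuous_upperPt (contDiff_flower (g := g)).continuous
  show Continuous fun t => Rk g k (upperPt (flower g) (level g) (pol capR ((1 - 2 * t) * π / g)))
  exact (Rk g k).continuous.comp (h2.comp h1)

/-- **The `k`-th truncated arc** as a path from the lower pole to the cap point. -/
def tArc (hg : 2 ≤ g) (k : ℕ) : Path (bot g) (capPt hg k) where
  toFun t := tArcFun hg k t
  continuous_toFun := (continuous_tArcFun hg k).comp continuous_subtype_val
  source' := tArcFun_zero_eq_bot hg k
  target' := tArcFun_one hg k

/-- The truncated arc path, pointwise. -/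
theorem tArc_apply (hg : 2 ≤ g) (k : ℕ) (t : unitInterval) : tArc hg k t = tArcFun hg k t := rfl

/-- **The cap-circle arc inside the `k`-th slice** as a path between consecutive cap points. -/
def capArc (hg : 2 ≤ g) (k : ℕ) : Path (capPt hg k) (capPt hg (k + 1)) where
  toFun t := capArcFun g k t
  continuous_toFun := (continuous_capArcFun g k).comp continuous_subtype_val
  source' := capArcFun_zero hg k
  target' := capArcFun_one hg k

/-- The cap-circle arc path, pointwise. -/
theorem capArc_apply (hg : 2 ≤ g) (k : ℕ) (t : unitInterval) : capArc hg k t = capArcFun g k t := rfl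

/-- **The boundary loop of the `k`-th capped slice** at the lower pole: up the `(k+1)`-st truncated
arc, back along the cap-circle arc, down the `k`-th truncated arc. -/
def capLoop (hg : 2 ≤ g) (k : ℕ) : Path (bot g) (bot g) :=
  ((tArc hg (k + 1)).trans (capArc hg k).symm).trans (tArc hg k).symm

/-! ### The toolkit statement (registered stub `stub_flowerCapToolkit`) -/

/-- **The flower-cap toolkit** (statement of the registered stub `stub_flowerCapToolkit`, proved
here): the endpoint identities of the truncated arcs and the cap-circle arcs, and the coordinate
formulas, for every `g ≥ 2` and every slice index `k`. -/
def FlowerCapToolkit : Prop :=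
  ∀ (g : ℕ) (hg : 2 ≤ g) (k : ℕ),
    tArcFun hg k 0 = bot g ∧ tArcFun hg k 1 = capPt hg k ∧
    capArcFun g k 0 = capPt hg k ∧ capArcFun g k 1 = capPt hg (k + 1) ∧
    capPt hg k = lift (pol capR (π / g + νk g k)) + vHt g capR • ez ∧
    (∀ t : ℝ, capArcFun g k t = lift (pol capR ((1 - 2 * t) * π / g + νk g k)) +
      Real.sqrt (level g - flower g (pol capR ((1 - 2 * t) * π / g))) • ez)

/-- **stub — the flower-cap toolkit**, proved. -/
theorem stub_flowerCapToolkit : FlowerCapToolkit :=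
  fun _ hg k => ⟨tArcFun_zero_eq_bot hg k, tArcFun_one hg k, capArcFun_zero hg k, capArcFun_one hg k,
    capPt_eq hg k, capArcFun_eq k⟩

end FlowerCap

end Summit.SmoothPoincare4.SmoothPoincare4.Cruxes.AgkCor6Sufficiency.LpBySphereSystemSurgery

end
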